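import Summits.HodgeConjecture.HodgeConjecture.Theorems.Ring2WeilCoverageWeilGramLevel32
import Summits.HodgeConjecture.HodgeConjecture.Theorems.Ring2WeilCoverageWeilGramTools
import Mathlib.Tactic.ComputeDegree
import HarnessLib

/-!
# Weil-type family coverage — NON-SPLIT `ℤ[ζ₃₂]`-CM EIGHTFOLDS, I: the form `(E_π₃₁ξ, i)`, `K_d = ℚ(i)` — fifteen traces,
# the `8 × 8` Hankel matrix, `det a = -3968 = −31·128` by an LU certificate (`N(π₃₁) = −31`; class of the type: `[31]`, NON-SPLIT)

research route conditional on HC_CM; not a corollary; Q11.4-sentence-2 already refuted in dim ≥ 3.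

Ring 2, WEIL-TYPE FAMILY-COVERAGE CENSUS (`HOME/WEIL-FAMILY-COVERAGE.md` `## b01`, block b01.50 (C); owner ring2-b01), part 200 of
the `Ring2WeilCoverage*` series; continues parts 155–158 (the principal type at `32`: `det a(ξ, i) = 128`, SPLIT).
At `32` THEOREM L (i) FAILS (part 61: `ℚ(ζ₃₂)⁺` has a unit of norm `−1`, e.g. `−1−θ`) and the norm-sign law degenerates:
EVERY principal-ideal type `(ϖ₀)`, `ϖ₀ ∈ ℤ[ζ₃₂]⁺ ∖ 0`, occurs on EVERY CM type (part 61 `exists_type_span_thirtyTwo`).  The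
component rule then reads: a skew `ζ′` of type `(ϖ₀)` is `u·ϖ₀ξ`, `u` a real unit of norm `±1`, so `det a(ζ′, s) =
±N(ϖ₀)·det a(ξ, s)`, and `Φ`-positivity on a `(4,4)` type fixes the sign: `det a = |N_{K⁺/ℚ}(ϖ₀)|·det a(ξ, s)` — class
`[2|N(ϖ₀)|] = [|N(ϖ₀)|]` (`det a(ξ, s_d) = 2^7 d^4`, and `2 ∈ Nm(ℚ(i)ˣ), Nm(ℚ(√−2)ˣ)`).  The smallest non-trivial class: the
prime `π₃₁ = −1 − 2θ + θ²` over `31 ≡ −1 (mod 32)` (inert in `K/K⁺`), `N(π₃₁) = −31`: rows `(4, ℚ(i), 31)`, `(4, ℚ(√−2), 31)`.  This file: the Gram data of `π₃₁ξ` (NOT `Φ`-positive on a `(4,4)` type — its determinant has the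
WRONG sign; the divisors of type `(π₃₁)` that ARE `Φ`-positive are the `uπ₃₁ξ` with `N(u) = −1`), from which part 202 reads
`N_{K⁺/ℚ}(π₃₁) = −31` and, with the law of part 199, places the type on `[31]`.
For a skew `ζ′` and a skew `s` with `s² = −d`
part 82 (`Ring2WeilCoverageWeilGramCMPoint`) shows that the Gram matrix `Ψ = a + b√−d` of van Geemen's hermitian form
`H = E(x, sy) + √−d E(x, y)`, `E = E_ζ′ = Tr_{K/ℚ}(ζ′xȳ)`, in a real frame is the rational matrix `a = (−Tr(ζ′s xᵢxⱼ))`,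
`b = 0`, with `det a = (−2)^g N_{K⁺/ℚ}(ζ′s) disc(ω)`; for `n = 4` (EVEN) the split class is `Nm` itself and a `Φ`-positive
`ζ′` on a Weil-type (`(4,4)`) CM type has `(−1)⁴ det a = det a > 0` (part 92).

* §1 `π₃₁ξi` reduced, the fifteen traces, and the Gram datum **`a = −(Tr(π₃₁ξ i θ^{i+j}))`, `det a = -3968 = −31·128`**.

HONEST FRAMING as parts 82–199: kernel statements about traces in `ℚ(ζ₃₂)` and the rational Gram matrices `(a, b)` of part 82
(hypotheses `ha`); nothing about Hodge classes, `W_K`, general members or HC; `HC_CM` is used nowhere.  No `def`, no named fact,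
no `sorry`.  Certificates produced by `work/py/geng.py` + `detcert.py` + `law32.py` (exact arithmetic, stdlib) and re-verified here
by `linear_combination` / `decide`.

References: [cite: vanGeemen1994HodgeAV, Lemma 5.2 (2)–(4), 5.4 and (5.4.1)]; [cite: Shimura1998, §14.3 Prop. 4–5,
pp. 103–104]; [cite: NeukirchANT1999, Ch. III (2.4)] (Euler); census b01.50 (seat-derived).
-/

noncomputable section

open Polynomial NumberField Module
open scoped nonZeroDivisors

namespace Summit.HodgeConjecture.Ring2WeilCoverage.WeilGramLevel32PrimeThirtyOneSqrtNegOne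

open Literature.AlgebraicGeometry.VanGeemen1994 (weilField weilNormResidueGroup)
open Literature.AlgebraicGeometry.Motives (CMType normUnitsSubgroup)
open Literature.NumberTheory.ComplexMultiplication
open Summit.HodgeConjecture.Ring2WeilCoverage.WeilGramTools
open Summit.HodgeConjecture.Ring2WeilCoverage.WeilGramCMPoint
open Summit.HodgeConjecture.Ring2WeilCoverage.RealUnitNormHalfSystems (complexConj_eq_inv)
open Summit.HodgeConjecture.Ring2WeilCoverage.CyclotomicPrincipalObstruction (complexConj_xi)
open Summit.HodgeConjecture.Ring2WeilCoverage.CyclotomicDifferent (isOfType_one_xi_top xi_ne_zero)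
open Summit.HodgeConjecture.HodgeConjecture.Ring2.WeilCoverage (mk_neg_eq_split_of_odd mk_neg_ne_split_of_odd
  mk_eq_split_of_even mk_ne_split_of_even mem_normUnitsSubgroup_of_sq_add_mul_sq natCast_not_mem_normUnitsSubgroup_of_ramified)
open Summit.HodgeConjecture.HodgeConjecture.Ring2.Hypotheses (splitDiscriminantClass)
open Summit.HodgeConjecture.Ring2WeilCoverage.WeilGramLevel32
variable {K : Type} [Field K] [NumberField K] {ζ : K}

/-! ### §1 The form `(E_π₃₁ξ, i)`: fifteen traces, the `8 × 8` Hankel matrix, `det a = -3968` -/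

/-- **`ζ′s·Φ₍32₎′(ζ)` reduced**: `ζ′s = r(ζ)·Φ′(ζ)⁻¹` with `deg r < 16` for `ζ′ = π₃₁ξ, π₃₁ = −1−2θ+θ²`, `s = √−1 = ζ⁸ = i` (certificate
`mod Φ_32`, `ζ^32 = 1`). research route conditional on HC_CM; not a corollary; Q11.4-sentence-2 already refuted in dim ≥ 3. [folklore] -/
theorem red_primeThirtyOne_sqrtNegOne (hζ : IsPrimitiveRoot ζ 32) :
    ((-1 - 2 * (ζ + ζ ^ 31) + (ζ + ζ ^ 31) ^ 2) * (ζ ^ 7 * (aeval ζ (derivative (cyclotomic 32 ℚ)))⁻¹)) * (ζ ^ 8) =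
      (2 - ζ + ζ ^ 13 - 2 * ζ ^ 14 + ζ ^ 15) *
        (aeval ζ (derivative (cyclotomic 32 ℚ)))⁻¹ := by
  have h32 : ζ ^ 32 = 1 := hζ.pow_eq_one
  have hΦ := cyc_thirtyTwo hζ
  linear_combination ((aeval ζ (derivative (cyclotomic 32 ℚ)))⁻¹ * (-2 + ζ)) * hΦ +
      ((aeval ζ (derivative (cyclotomic 32 ℚ)))⁻¹ * (ζ^13 - 2 * ζ^14 + 2 * ζ^15 + ζ^45)) * h32

/-- `Tr(ζ′sθ^0) = 1` for `ζ′ = π₃₁ξ, π₃₁ = −1−2θ+θ²`, `s = √−1 = ζ⁸ = i`, `θ = ζ + ζ⁻¹` (Euler evaluation). research route conditional on HC_CM; not a corollary; Q11.4-sentence-2 already refuted in dim ≥ 3. [folklore] -/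
theorem trace_primeThirtyOne_sqrtNegOne_zero [IsCyclotomicExtension {32} ℚ K] (hζ : IsPrimitiveRoot ζ 32) :
    Algebra.trace ℚ K (((-1 - 2 * (ζ + ζ ^ 31) + (ζ + ζ ^ 31) ^ 2) * (ζ ^ 7 * (aeval ζ (derivative (cyclotomic 32 ℚ)))⁻¹)) * (ζ ^ 8)) = 1 := by
  rw [trace_of_key₀ hζ (by decide : Nat.totient 32 = 15 + 1) (C (2 : ℚ) + C (-1 : ℚ) * X + C (0 : ℚ) * X ^ 2 + C (0 : ℚ) * X ^ 3 + C (0 : ℚ) * X ^ 4 + C (0 : ℚ) * X ^ 5 +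
      C (0 : ℚ) * X ^ 6 + C (0 : ℚ) * X ^ 7 + C (0 : ℚ) * X ^ 8 + C (0 : ℚ) * X ^ 9 + C (0 : ℚ) * X ^ 10 +
      C (0 : ℚ) * X ^ 11 + C (0 : ℚ) * X ^ 12 + C (1 : ℚ) * X ^ 13 + C (-2 : ℚ) * X ^ 14 + C (1 : ℚ) * X ^ 15) (by compute_degree) (by
    rw [red_primeThirtyOne_sqrtNegOne hζ]
    simp only [map_add, map_mul, map_pow, aeval_C, aeval_X, eq_ratCast]
    push_cast
    ring)]
  norm_num [coeff_X_pow, coeff_X, coeff_C, coeff_one]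

/-- `Tr(ζ′sθ^1) = -4` for `ζ′ = π₃₁ξ, π₃₁ = −1−2θ+θ²`, `s = √−1 = ζ⁸ = i`, `θ = ζ + ζ⁻¹` (Euler evaluation). research route conditional on HC_CM; not a corollary; Q11.4-sentence-2 already refuted in dim ≥ 3. [folklore] -/
theorem trace_primeThirtyOne_sqrtNegOne_one [IsCyclotomicExtension {32} ℚ K] (hζ : IsPrimitiveRoot ζ 32) :
    Algebra.trace ℚ K (((-1 - 2 * (ζ + ζ ^ 31) + (ζ + ζ ^ 31) ^ 2) * (ζ ^ 7 * (aeval ζ (derivative (cyclotomic 32 ℚ)))⁻¹)) * (ζ ^ 8) * (ζ + ζ⁻¹)) = -4 := by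
  have hΦ := cyc_thirtyTwo hζ
  rw [trace_of_key₁ hζ (by decide : Nat.totient 32 = 15 + 1) (C (-2 : ℚ) + C (2 : ℚ) * X + C (-1 : ℚ) * X ^ 2 + C (0 : ℚ) * X ^ 3 + C (0 : ℚ) * X ^ 4 + C (0 : ℚ) * X ^ 5 +
      C (0 : ℚ) * X ^ 6 + C (0 : ℚ) * X ^ 7 + C (0 : ℚ) * X ^ 8 + C (0 : ℚ) * X ^ 9 + C (0 : ℚ) * X ^ 10 +
      C (0 : ℚ) * X ^ 11 + C (1 : ℚ) * X ^ 12 + C (-2 : ℚ) * X ^ 13 + C (2 : ℚ) * X ^ 14 + C (-4 : ℚ) * X ^ 15) (by compute_degree) (by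
    rw [red_primeThirtyOne_sqrtNegOne hζ]
    simp only [map_add, map_mul, map_pow, aeval_C, aeval_X, eq_ratCast]
    push_cast
    linear_combination ((aeval ζ (derivative (cyclotomic 32 ℚ)))⁻¹ * (2 + ζ)) * hΦ)]
  norm_num [coeff_X_pow, coeff_X, coeff_C, coeff_one]

/-- `Tr(ζ′sθ^2) = 4` for `ζ′ = π₃₁ξ, π₃₁ = −1−2θ+θ²`, `s = √−1 = ζ⁸ = i`, `θ = ζ + ζ⁻¹` (Euler evaluation). research route conditional on HC_CM; not a corollary; Q11.4-sentence-2 already refuted in dim ≥ 3. [folklore] -/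
theorem trace_primeThirtyOne_sqrtNegOne_two [IsCyclotomicExtension {32} ℚ K] (hζ : IsPrimitiveRoot ζ 32) :
    Algebra.trace ℚ K (((-1 - 2 * (ζ + ζ ^ 31) + (ζ + ζ ^ 31) ^ 2) * (ζ ^ 7 * (aeval ζ (derivative (cyclotomic 32 ℚ)))⁻¹)) * (ζ ^ 8) * (ζ + ζ⁻¹) ^ 2) = 4 := by
  have hΦ := cyc_thirtyTwo hζ
  rw [trace_of_key hζ (by decide : Nat.totient 32 = 15 + 1) (C (6 : ℚ) + C (-3 : ℚ) * X + C (2 : ℚ) * X ^ 2 + C (-1 : ℚ) * X ^ 3 + C (0 : ℚ) * X ^ 4 + C (0 : ℚ) * X ^ 5 +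
      C (0 : ℚ) * X ^ 6 + C (0 : ℚ) * X ^ 7 + C (0 : ℚ) * X ^ 8 + C (0 : ℚ) * X ^ 9 + C (0 : ℚ) * X ^ 10 +
      C (1 : ℚ) * X ^ 11 + C (-2 : ℚ) * X ^ 12 + C (3 : ℚ) * X ^ 13 + C (-6 : ℚ) * X ^ 14 + C (4 : ℚ) * X ^ 15) (by compute_degree) (by
    rw [red_primeThirtyOne_sqrtNegOne hζ]
    simp only [map_add, map_mul, map_pow, aeval_C, aeval_X, eq_ratCast]
    push_cast
    linear_combination ((aeval ζ (derivative (cyclotomic 32 ℚ)))⁻¹ * (2 - ζ - 2 * ζ^2 + ζ^3)) * hΦ)]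
  norm_num [coeff_X_pow, coeff_X, coeff_C, coeff_one]

/-- `Tr(ζ′sθ^3) = -12` for `ζ′ = π₃₁ξ, π₃₁ = −1−2θ+θ²`, `s = √−1 = ζ⁸ = i`, `θ = ζ + ζ⁻¹` (Euler evaluation). research route conditional on HC_CM; not a corollary; Q11.4-sentence-2 already refuted in dim ≥ 3. [folklore] -/
theorem trace_primeThirtyOne_sqrtNegOne_three [IsCyclotomicExtension {32} ℚ K] (hζ : IsPrimitiveRoot ζ 32) :
    Algebra.trace ℚ K (((-1 - 2 * (ζ + ζ ^ 31) + (ζ + ζ ^ 31) ^ 2) * (ζ ^ 7 * (aeval ζ (derivative (cyclotomic 32 ℚ)))⁻¹)) * (ζ ^ 8) * (ζ + ζ⁻¹) ^ 3) = -12 := by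
  have hΦ := cyc_thirtyTwo hζ
  rw [trace_of_key hζ (by decide : Nat.totient 32 = 15 + 1) (C (-7 : ℚ) + C (8 : ℚ) * X + C (-4 : ℚ) * X ^ 2 + C (2 : ℚ) * X ^ 3 + C (-1 : ℚ) * X ^ 4 + C (0 : ℚ) * X ^ 5 +
      C (0 : ℚ) * X ^ 6 + C (0 : ℚ) * X ^ 7 + C (0 : ℚ) * X ^ 8 + C (0 : ℚ) * X ^ 9 + C (1 : ℚ) * X ^ 10 +
      C (-2 : ℚ) * X ^ 11 + C (4 : ℚ) * X ^ 12 + C (-8 : ℚ) * X ^ 13 + C (7 : ℚ) * X ^ 14 + C (-12 : ℚ) * X ^ 15) (by compute_degree) (by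
    rw [red_primeThirtyOne_sqrtNegOne hζ]
    simp only [map_add, map_mul, map_pow, aeval_C, aeval_X, eq_ratCast]
    push_cast
    linear_combination ((aeval ζ (derivative (cyclotomic 32 ℚ)))⁻¹ * (2 - ζ + 6 * ζ^2 + 4 * ζ^3 - 2 * ζ^4 + ζ^5)) * hΦ)]
  norm_num [coeff_X_pow, coeff_X, coeff_C, coeff_one]

/-- `Tr(ζ′sθ^4) = 14` for `ζ′ = π₃₁ξ, π₃₁ = −1−2θ+θ²`, `s = √−1 = ζ⁸ = i`, `θ = ζ + ζ⁻¹` (Euler evaluation). research route conditional on HC_CM; not a corollary; Q11.4-sentence-2 already refuted in dim ≥ 3. [folklore] -/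
theorem trace_primeThirtyOne_sqrtNegOne_four [IsCyclotomicExtension {32} ℚ K] (hζ : IsPrimitiveRoot ζ 32) :
    Algebra.trace ℚ K (((-1 - 2 * (ζ + ζ ^ 31) + (ζ + ζ ^ 31) ^ 2) * (ζ ^ 7 * (aeval ζ (derivative (cyclotomic 32 ℚ)))⁻¹)) * (ζ ^ 8) * (ζ + ζ⁻¹) ^ 4) = 14 := by
  have hΦ := cyc_thirtyTwo hζ
  rw [trace_of_key hζ (by decide : Nat.totient 32 = 15 + 1) (C (20 : ℚ) + C (-11 : ℚ) * X + C (10 : ℚ) * X ^ 2 + C (-5 : ℚ) * X ^ 3 + C (2 : ℚ) * X ^ 4 + C (-1 : ℚ) * X ^ 5 +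
      C (0 : ℚ) * X ^ 6 + C (0 : ℚ) * X ^ 7 + C (0 : ℚ) * X ^ 8 + C (1 : ℚ) * X ^ 9 + C (-2 : ℚ) * X ^ 10 +
      C (5 : ℚ) * X ^ 11 + C (-10 : ℚ) * X ^ 12 + C (11 : ℚ) * X ^ 13 + C (-20 : ℚ) * X ^ 14 + C (14 : ℚ) * X ^ 15) (by compute_degree) (by
    rw [red_primeThirtyOne_sqrtNegOne hζ]
    simp only [map_add, map_mul, map_pow, aeval_C, aeval_X, eq_ratCast]
    push_cast
    linear_combination ((aeval ζ (derivative (cyclotomic 32 ℚ)))⁻¹ * (2 - ζ + 8 * ζ^2 - 4 * ζ^3 - 8 * ζ^4 + 5 * ζ^5 - 2 * ζ^6 + ζ^7)) * hΦ)]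
  norm_num [coeff_X_pow, coeff_X, coeff_C, coeff_one]

/-- `Tr(ζ′sθ^5) = -40` for `ζ′ = π₃₁ξ, π₃₁ = −1−2θ+θ²`, `s = √−1 = ζ⁸ = i`, `θ = ζ + ζ⁻¹` (Euler evaluation). research route conditional on HC_CM; not a corollary; Q11.4-sentence-2 already refuted in dim ≥ 3. [folklore] -/
theorem trace_primeThirtyOne_sqrtNegOne_five [IsCyclotomicExtension {32} ℚ K] (hζ : IsPrimitiveRoot ζ 32) :
    Algebra.trace ℚ K (((-1 - 2 * (ζ + ζ ^ 31) + (ζ + ζ ^ 31) ^ 2) * (ζ ^ 7 * (aeval ζ (derivative (cyclotomic 32 ℚ)))⁻¹)) * (ζ ^ 8) * (ζ + ζ⁻¹) ^ 5) = -40 := by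
  have hΦ := cyc_thirtyTwo hζ
  rw [trace_of_key hζ (by decide : Nat.totient 32 = 15 + 1) (C (-25 : ℚ) + C (30 : ℚ) * X + C (-16 : ℚ) * X ^ 2 + C (12 : ℚ) * X ^ 3 + C (-6 : ℚ) * X ^ 4 + C (2 : ℚ) * X ^ 5 +
      C (-1 : ℚ) * X ^ 6 + C (0 : ℚ) * X ^ 7 + C (1 : ℚ) * X ^ 8 + C (-2 : ℚ) * X ^ 9 + C (6 : ℚ) * X ^ 10 +
      C (-12 : ℚ) * X ^ 11 + C (16 : ℚ) * X ^ 12 + C (-30 : ℚ) * X ^ 13 + C (25 : ℚ) * X ^ 14 + C (-40 : ℚ) * X ^ 15) (by compute_degree) (by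
    rw [red_primeThirtyOne_sqrtNegOne hζ]
    simp only [map_add, map_mul, map_pow, aeval_C, aeval_X, eq_ratCast]
    push_cast
    linear_combination ((aeval ζ (derivative (cyclotomic 32 ℚ)))⁻¹ * (2 - ζ + 10 * ζ^2 - 5 * ζ^3 + 20 * ζ^4 + 15 * ζ^5 - 10 * ζ^6 + 6 * ζ^7 - 2 * ζ^8 + ζ^9)) * hΦ)]
  norm_num [coeff_X_pow, coeff_X, coeff_C, coeff_one]

/-- `Tr(ζ′sθ^6) = 50` for `ζ′ = π₃₁ξ, π₃₁ = −1−2θ+θ²`, `s = √−1 = ζ⁸ = i`, `θ = ζ + ζ⁻¹` (Euler evaluation). research route conditional on HC_CM; not a corollary; Q11.4-sentence-2 already refuted in dim ≥ 3. [folklore] -/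
theorem trace_primeThirtyOne_sqrtNegOne_six [IsCyclotomicExtension {32} ℚ K] (hζ : IsPrimitiveRoot ζ 32) :
    Algebra.trace ℚ K (((-1 - 2 * (ζ + ζ ^ 31) + (ζ + ζ ^ 31) ^ 2) * (ζ ^ 7 * (aeval ζ (derivative (cyclotomic 32 ℚ)))⁻¹)) * (ζ ^ 8) * (ζ + ζ⁻¹) ^ 6) = 50 := by
  have hΦ := cyc_thirtyTwo hζ
  rw [trace_of_key hζ (by decide : Nat.totient 32 = 15 + 1) (C (70 : ℚ) + C (-41 : ℚ) * X + C (42 : ℚ) * X ^ 2 + C (-22 : ℚ) * X ^ 3 + C (14 : ℚ) * X ^ 4 +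
      C (-7 : ℚ) * X ^ 5 + C (2 : ℚ) * X ^ 6 + C (0 : ℚ) * X ^ 7 + C (-2 : ℚ) * X ^ 8 + C (7 : ℚ) * X ^ 9 +
      C (-14 : ℚ) * X ^ 10 + C (22 : ℚ) * X ^ 11 + C (-42 : ℚ) * X ^ 12 + C (41 : ℚ) * X ^ 13 + C (-70 : ℚ) * X ^ 14 +
      C (50 : ℚ) * X ^ 15) (by compute_degree) (by
    rw [red_primeThirtyOne_sqrtNegOne hζ]
    simp only [map_add, map_mul, map_pow, aeval_C, aeval_X, eq_ratCast]
    push_cast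
    linear_combination ((aeval ζ (derivative (cyclotomic 32 ℚ)))⁻¹ * (2 - ζ + 12 * ζ^2 - 6 * ζ^3 + 30 * ζ^4 - 15 * ζ^5 - 30 * ζ^6 + 21 * ζ^7 - 12 * ζ^8 + 7 * ζ^9 - 2 * ζ^10 +
        ζ^11)) * hΦ)]
  norm_num [coeff_X_pow, coeff_X, coeff_C, coeff_one]

/-- `Tr(ζ′sθ^7) = -140` for `ζ′ = π₃₁ξ, π₃₁ = −1−2θ+θ²`, `s = √−1 = ζ⁸ = i`, `θ = ζ + ζ⁻¹` (Euler evaluation). research route conditional on HC_CM; not a corollary; Q11.4-sentence-2 already refuted in dim ≥ 3. [folklore] -/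
theorem trace_primeThirtyOne_sqrtNegOne_seven [IsCyclotomicExtension {32} ℚ K] (hζ : IsPrimitiveRoot ζ 32) :
    Algebra.trace ℚ K (((-1 - 2 * (ζ + ζ ^ 31) + (ζ + ζ ^ 31) ^ 2) * (ζ ^ 7 * (aeval ζ (derivative (cyclotomic 32 ℚ)))⁻¹)) * (ζ ^ 8) * (ζ + ζ⁻¹) ^ 7) = -140 := by
  have hΦ := cyc_thirtyTwo hζ
  rw [trace_of_key hζ (by decide : Nat.totient 32 = 15 + 1) (C (-91 : ℚ) + C (112 : ℚ) * X + C (-63 : ℚ) * X ^ 2 + C (56 : ℚ) * X ^ 3 + C (-29 : ℚ) * X ^ 4 +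
      C (16 : ℚ) * X ^ 5 + C (-7 : ℚ) * X ^ 6 + C (0 : ℚ) * X ^ 7 + C (7 : ℚ) * X ^ 8 + C (-16 : ℚ) * X ^ 9 +
      C (29 : ℚ) * X ^ 10 + C (-56 : ℚ) * X ^ 11 + C (63 : ℚ) * X ^ 12 + C (-112 : ℚ) * X ^ 13 + C (91 : ℚ) * X ^ 14 +
      C (-140 : ℚ) * X ^ 15) (by compute_degree) (by
    rw [red_primeThirtyOne_sqrtNegOne hζ]
    simp only [map_add, map_mul, map_pow, aeval_C, aeval_X, eq_ratCast]
    push_cast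
    linear_combination ((aeval ζ (derivative (cyclotomic 32 ℚ)))⁻¹ * (2 - ζ + 14 * ζ^2 - 7 * ζ^3 + 42 * ζ^4 - 21 * ζ^5 + 70 * ζ^6 + 56 * ζ^7 - 42 * ζ^8 + 28 * ζ^9 - 14 * ζ^10 +
        8 * ζ^11 - 2 * ζ^12 + ζ^13)) * hΦ)]
  norm_num [coeff_X_pow, coeff_X, coeff_C, coeff_one]

/-- `Tr(ζ′sθ^8) = 182` for `ζ′ = π₃₁ξ, π₃₁ = −1−2θ+θ²`, `s = √−1 = ζ⁸ = i` (trace recurrence from `θ^8`). research route conditional on HC_CM; not a corollary; Q11.4-sentence-2 already refuted in dim ≥ 3. [folklore] -/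
theorem trace_primeThirtyOne_sqrtNegOne_eight [IsCyclotomicExtension {32} ℚ K] (hζ : IsPrimitiveRoot ζ 32) :
    Algebra.trace ℚ K (((-1 - 2 * (ζ + ζ ^ 31) + (ζ + ζ ^ 31) ^ 2) * (ζ ^ 7 * (aeval ζ (derivative (cyclotomic 32 ℚ)))⁻¹)) * (ζ ^ 8) * (ζ + ζ⁻¹) ^ 8) = 182 := by
  rw [trace_mul_theta_pow_eight hζ, trace_primeThirtyOne_sqrtNegOne_zero hζ, trace_primeThirtyOne_sqrtNegOne_two hζ,
    trace_primeThirtyOne_sqrtNegOne_four hζ, trace_primeThirtyOne_sqrtNegOne_six hζ]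
  norm_num

/-- `Tr(ζ′sθ^9) = -504` for `ζ′ = π₃₁ξ, π₃₁ = −1−2θ+θ²`, `s = √−1 = ζ⁸ = i` (trace recurrence from `θ^8`). research route conditional on HC_CM; not a corollary; Q11.4-sentence-2 already refuted in dim ≥ 3. [folklore] -/
theorem trace_primeThirtyOne_sqrtNegOne_nine [IsCyclotomicExtension {32} ℚ K] (hζ : IsPrimitiveRoot ζ 32) :
    Algebra.trace ℚ K (((-1 - 2 * (ζ + ζ ^ 31) + (ζ + ζ ^ 31) ^ 2) * (ζ ^ 7 * (aeval ζ (derivative (cyclotomic 32 ℚ)))⁻¹)) * (ζ ^ 8) * (ζ + ζ⁻¹) ^ 9) = -504 := by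
  rw [trace_mul_theta_pow_nine hζ, trace_primeThirtyOne_sqrtNegOne_one hζ, trace_primeThirtyOne_sqrtNegOne_three hζ,
    trace_primeThirtyOne_sqrtNegOne_five hζ, trace_primeThirtyOne_sqrtNegOne_seven hζ]
  norm_num

/-- `Tr(ζ′sθ^10) = 672` for `ζ′ = π₃₁ξ, π₃₁ = −1−2θ+θ²`, `s = √−1 = ζ⁸ = i` (trace recurrence from `θ^8`). research route conditional on HC_CM; not a corollary; Q11.4-sentence-2 already refuted in dim ≥ 3. [folklore] -/
theorem trace_primeThirtyOne_sqrtNegOne_ten [IsCyclotomicExtension {32} ℚ K] (hζ : IsPrimitiveRoot ζ 32) :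
    Algebra.trace ℚ K (((-1 - 2 * (ζ + ζ ^ 31) + (ζ + ζ ^ 31) ^ 2) * (ζ ^ 7 * (aeval ζ (derivative (cyclotomic 32 ℚ)))⁻¹)) * (ζ ^ 8) * (ζ + ζ⁻¹) ^ 10) = 672 := by
  rw [trace_mul_theta_pow_ten hζ, trace_primeThirtyOne_sqrtNegOne_two hζ, trace_primeThirtyOne_sqrtNegOne_four hζ,
    trace_primeThirtyOne_sqrtNegOne_six hζ, trace_primeThirtyOne_sqrtNegOne_eight hζ]
  norm_num

/-- `Tr(ζ′sθ^11) = -1848` for `ζ′ = π₃₁ξ, π₃₁ = −1−2θ+θ²`, `s = √−1 = ζ⁸ = i` (trace recurrence from `θ^8`). research route conditional on HC_CM; not a corollary; Q11.4-sentence-2 already refuted in dim ≥ 3. [folklore] -/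
theorem trace_primeThirtyOne_sqrtNegOne_eleven [IsCyclotomicExtension {32} ℚ K] (hζ : IsPrimitiveRoot ζ 32) :
    Algebra.trace ℚ K (((-1 - 2 * (ζ + ζ ^ 31) + (ζ + ζ ^ 31) ^ 2) * (ζ ^ 7 * (aeval ζ (derivative (cyclotomic 32 ℚ)))⁻¹)) * (ζ ^ 8) * (ζ + ζ⁻¹) ^ 11) = -1848 := by
  rw [trace_mul_theta_pow_eleven hζ, trace_primeThirtyOne_sqrtNegOne_three hζ, trace_primeThirtyOne_sqrtNegOne_five hζ,
    trace_primeThirtyOne_sqrtNegOne_seven hζ, trace_primeThirtyOne_sqrtNegOne_nine hζ]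
  norm_num

/-- `Tr(ζ′sθ^12) = 2508` for `ζ′ = π₃₁ξ, π₃₁ = −1−2θ+θ²`, `s = √−1 = ζ⁸ = i` (trace recurrence from `θ^8`). research route conditional on HC_CM; not a corollary; Q11.4-sentence-2 already refuted in dim ≥ 3. [folklore] -/
theorem trace_primeThirtyOne_sqrtNegOne_twelve [IsCyclotomicExtension {32} ℚ K] (hζ : IsPrimitiveRoot ζ 32) :
    Algebra.trace ℚ K (((-1 - 2 * (ζ + ζ ^ 31) + (ζ + ζ ^ 31) ^ 2) * (ζ ^ 7 * (aeval ζ (derivative (cyclotomic 32 ℚ)))⁻¹)) * (ζ ^ 8) * (ζ + ζ⁻¹) ^ 12) = 2508 := by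
  rw [trace_mul_theta_pow_twelve hζ, trace_primeThirtyOne_sqrtNegOne_four hζ, trace_primeThirtyOne_sqrtNegOne_six hζ,
    trace_primeThirtyOne_sqrtNegOne_eight hζ, trace_primeThirtyOne_sqrtNegOne_ten hζ]
  norm_num

/-- `Tr(ζ′sθ^13) = -6864` for `ζ′ = π₃₁ξ, π₃₁ = −1−2θ+θ²`, `s = √−1 = ζ⁸ = i` (trace recurrence from `θ^8`). research route conditional on HC_CM; not a corollary; Q11.4-sentence-2 already refuted in dim ≥ 3. [folklore] -/
theorem trace_primeThirtyOne_sqrtNegOne_thirteen [IsCyclotomicExtension {32} ℚ K] (hζ : IsPrimitiveRoot ζ 32) :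
    Algebra.trace ℚ K (((-1 - 2 * (ζ + ζ ^ 31) + (ζ + ζ ^ 31) ^ 2) * (ζ ^ 7 * (aeval ζ (derivative (cyclotomic 32 ℚ)))⁻¹)) * (ζ ^ 8) * (ζ + ζ⁻¹) ^ 13) = -6864 := by
  rw [trace_mul_theta_pow_thirteen hζ, trace_primeThirtyOne_sqrtNegOne_five hζ, trace_primeThirtyOne_sqrtNegOne_seven hζ,
    trace_primeThirtyOne_sqrtNegOne_nine hζ, trace_primeThirtyOne_sqrtNegOne_eleven hζ]
  norm_num

/-- `Tr(ζ′sθ^14) = 9436` for `ζ′ = π₃₁ξ, π₃₁ = −1−2θ+θ²`, `s = √−1 = ζ⁸ = i` (trace recurrence from `θ^8`). research route conditional on HC_CM; not a corollary; Q11.4-sentence-2 already refuted in dim ≥ 3. [folklore] -/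
theorem trace_primeThirtyOne_sqrtNegOne_fourteen [IsCyclotomicExtension {32} ℚ K] (hζ : IsPrimitiveRoot ζ 32) :
    Algebra.trace ℚ K (((-1 - 2 * (ζ + ζ ^ 31) + (ζ + ζ ^ 31) ^ 2) * (ζ ^ 7 * (aeval ζ (derivative (cyclotomic 32 ℚ)))⁻¹)) * (ζ ^ 8) * (ζ + ζ⁻¹) ^ 14) = 9436 := by
  rw [trace_mul_theta_pow_fourteen hζ, trace_primeThirtyOne_sqrtNegOne_six hζ, trace_primeThirtyOne_sqrtNegOne_eight hζ,
    trace_primeThirtyOne_sqrtNegOne_ten hζ, trace_primeThirtyOne_sqrtNegOne_twelve hζ]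
  norm_num

/-- **The Gram datum `a` of `(E_ζ′, s)` in the real frame `θ^i` (`i < 8`)** for `ζ′ = π₃₁ξ, π₃₁ = −1−2θ+θ²` (type (π₃₁): `𝔬𝔣₀ = (π₃₁)`, `N(π₃₁) = −31`),
`s = √−1 = ζ⁸ = i`: the integer Hankel matrix `(−Tr(ζ′sθ^{i+j}))ᵢⱼ` (and `b = 0`, part 82 `hb_eq_zero`).
research route conditional on HC_CM; not a corollary; Q11.4-sentence-2 already refuted in dim ≥ 3. [cite: vanGeemen1994HodgeAV, Lemma 5.2 (2)–(3)] -/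
theorem realPart_primeThirtyOne_sqrtNegOne [IsCyclotomicExtension {32} ℚ K] [IsCMField K] (hζ : IsPrimitiveRoot ζ 32)
    {x : Fin 8 → K} (hx : ∀ i, x i = (ζ + ζ⁻¹) ^ (i : ℕ)) {a : Matrix (Fin 8) (Fin 8) ℚ}
    (ha : ∀ i j, a i j = Algebra.trace ℚ K (((-1 - 2 * (ζ + ζ ^ 31) + (ζ + ζ ^ 31) ^ 2) * (ζ ^ 7 * (aeval ζ (derivative (cyclotomic 32 ℚ)))⁻¹)) * x i * IsCMField.complexConj K ((ζ ^ 8) * x j))) :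
    a = !![-1, 4, -4, 12, -14, 40, -50, 140;
        4, -4, 12, -14, 40, -50, 140, -182;
        -4, 12, -14, 40, -50, 140, -182, 504;
        12, -14, 40, -50, 140, -182, 504, -672;
        -14, 40, -50, 140, -182, 504, -672, 1848;
        40, -50, 140, -182, 504, -672, 1848, -2508;
        -50, 140, -182, 504, -672, 1848, -2508, 6864;
        140, -182, 504, -672, 1848, -2508, 6864, -9436] := by
  rw [ha_eq (complexConj_sqrtNegOne hζ) (complexConj_thetaFrame hζ hx) ha]
  ext i j
  simp only [Matrix.of_apply, hx, ← pow_add]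
  fin_cases i <;> fin_cases j <;> simp [trace_primeThirtyOne_sqrtNegOne_zero hζ, trace_primeThirtyOne_sqrtNegOne_one hζ,
    trace_primeThirtyOne_sqrtNegOne_two hζ, trace_primeThirtyOne_sqrtNegOne_three hζ,
    trace_primeThirtyOne_sqrtNegOne_four hζ, trace_primeThirtyOne_sqrtNegOne_five hζ,
    trace_primeThirtyOne_sqrtNegOne_six hζ, trace_primeThirtyOne_sqrtNegOne_seven hζ,
    trace_primeThirtyOne_sqrtNegOne_eight hζ, trace_primeThirtyOne_sqrtNegOne_nine hζ,
    trace_primeThirtyOne_sqrtNegOne_ten hζ, trace_primeThirtyOne_sqrtNegOne_eleven hζ,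
    trace_primeThirtyOne_sqrtNegOne_twelve hζ, trace_primeThirtyOne_sqrtNegOne_thirteen hζ,
    trace_primeThirtyOne_sqrtNegOne_fourteen hζ]

/-- **`det a = -3968`** for `ζ′ = π₃₁ξ, π₃₁ = −1−2θ+θ²`, `s = √−1 = ζ⁸ = i` (frame `θ^i`, `i < 8`), by an LU certificate `P·a[σ] = U`
(part 119 `det_eq_of_certificate`; `∏ Pᵢᵢ = 7335900`, `sign σ = 1`, `∏ Uᵢᵢ = -29108851200`). research route conditional on HC_CM; not a corollary; Q11.4-sentence-2 already refuted in dim ≥ 3. [cite: vanGeemen1994HodgeAV, Lemma 5.2 (3)] -/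
theorem det_realPart_primeThirtyOne_sqrtNegOne [IsCyclotomicExtension {32} ℚ K] [IsCMField K] (hζ : IsPrimitiveRoot ζ 32)
    {x : Fin 8 → K} (hx : ∀ i, x i = (ζ + ζ⁻¹) ^ (i : ℕ)) {a : Matrix (Fin 8) (Fin 8) ℚ}
    (ha : ∀ i j, a i j = Algebra.trace ℚ K (((-1 - 2 * (ζ + ζ ^ 31) + (ζ + ζ ^ 31) ^ 2) * (ζ ^ 7 * (aeval ζ (derivative (cyclotomic 32 ℚ)))⁻¹)) * x i * IsCMField.complexConj K ((ζ ^ 8) * x j))) :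
    a.det = -3968 := by
  rw [realPart_primeThirtyOne_sqrtNegOne hζ hx ha]
  exact det_eq_of_certificate
    !![1, 0, 0, 0, 0, 0, 0, 0;
      4, 1, 0, 0, 0, 0, 0, 0;
      -8, 1, 3, 0, 0, 0, 0, 0;
      28, -9, -10, 2, 0, 0, 0, 0;
      82, -44, -89, 14, 19, 0, 0, 0;
      -68, 88, 62, -65, -12, 11, 0, 0;
      -334, 444, 631, -370, -331, 68, 50, 0;
      532, -1515, -694, 2179, 268, -914, -32, 117]
    !![-1, 4, -4, 12, -14, 40, -50, 140;
      0, 12, -4, 34, -16, 110, -60, 378;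
      0, 0, 2, 10, 2, 50, -6, 210;
      0, 0, 0, -38, 28, -194, 168, -826;
      0, 0, 0, 0, 44, 48, 226, 336;
      0, 0, 0, 0, 0, -50, 68, -372;
      0, 0, 0, 0, 0, 0, 234, 64;
      0, 0, 0, 0, 0, 0, 0, 62]
    (1) (1) _ (by decide +kernel) (by decide +kernel) (by decide +kernel)
    (by decide +kernel) (by decide +kernel) (by decide +kernel)

end Summit.HodgeConjecture.Ring2WeilCoverage.WeilGramLevel32PrimeThirtyOneSqrtNegOne

end
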